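import Mathlib
import Literature.AlgebraicGeometry.CossartPiltant200819.OrderAtClosedPoint2009
import Summits.ResolutionOfSingularities.ResolutionOfSingularities.Theorems.FrobeniusClosingSteerPBasisDual
import HarnessLib

/-!
# Crux `Steer` (stmt-ResolutionOfSingularities-16345), chain W4.1 — **BUDGET `FarCleaningDepthFinite`**:
# in a DVR essentially of finite type over a perfect field, a non-`p`-th power has finite cleaning depth

OURS (campaign `res-hironaka`, rung L, slot W4.1, chain W4.1; replaces the role of no printed item; NOT a
statement of the manuscript under review [claim: Hironaka2017, status: under-review]; AI review is weaker
than expert review).  Theses-free, definition-free helper for res-L0-w41-idea-2's card 3 r2b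
`far-frame-exit-budget` (`L/res-L0-w41-idea-2/Sketch-idea-2e.lean` §G5b, the technique-B budget of the
line inside the registered residual `stub_nonSwitchingCore` / `NonSwitchingCoreM` of the line of record
`Cruxes/Steer/Lines/switching_dichotomy.lean`, holder res-L0-w41-lead-1):

> **`FarCleaningDepthFinite p`.** Let `k` be a perfect field of characteristic `p`, `D` a discrete
> valuation ring essentially of finite type over `k`, and `f ∈ D` not a `p`-th power in `Frac D`.  Then
> `f` has FINITE CLEANING DEPTH: there is `N` with `f − g ^ p ∉ 𝔪_D ^ N` for every `g ∈ D`.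

The main theorem `farCleaningDepthFinite` is the LITERAL body of the sketch's
`def FarCleaningDepthFinite (p : ℕ) : Prop`, universally quantified over `p` (it closes
`FarCleaningDepthFinite p` by `exact farCleaningDepthFinite p` for every `p`; for `p = 0` — `CharP k 0` —
the statement says `f ≠ 1 ⇒ ∃ N, f − 1 ∉ 𝔪 ^ N` and holds by Krull's intersection theorem alone).

## Proof (namespace `…Theorems.SwitchingDichotomy.FarCleaningDepth`)

* **Detection** (tree, P `PBasisDual.exists_derivation_commonKernel`, p504438): `F = Frac D` is finitely
  generated over the perfect field `k`, so a finite family of derivations of `F` has common kernel `F^p`;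
  as `f ∉ F^p`, some `δ ∈ Der(F)` has `δ f ≠ 0`.
* **Denominators** (`exists_denominator`): `D` is a localisation of `k[x₁, …, xₙ] ⊆ D` at units; with `c`
  the product of denominators of the `δ xᵢ`, `c · δ(D) ⊆ D` (`Algebra.adjoin_induction`; `δ` kills
  `k = k^p`; a unit denominator `t` is removed by `t⁻¹ ∈ D`).
* **Restriction** (`exists_restrict`): `∂ := c · δ|_D` is a derivation of `D` with `∂ f ≠ 0`.
* **Budget**: derivations kill `p`-th powers and lower `𝔪`-adic orders by at most one (tree,
  `OrderAtClosedPoint.derivation_apply_mem_pow` / `derivation_apply_pow_char`), so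
  `f − g^p ∈ 𝔪^{M+1}` forces `∂ f ∈ 𝔪^M`; Krull's intersection theorem gives `M` with `∂ f ∉ 𝔪^M`, whence
  `N = M + 1`.

Elementary; no named facts, no definitions, no `sorry`. [cite: Matsumura1987, §26 Thm. 26.5 (p-bases and
derivations over a perfect field)] [cite: HeinzerEtAl2015, Thm. 4.1 (2) (context: far primes of the
Noetherian hull)] [folklore]
-/

noncomputable section

-- `Summit.<S>.<S>.…` duplicates the summit name by design (single-problem summit).
set_option linter.dupNamespace false
set_option autoImplicit false

namespace Summit.ResolutionOfSingularities.ResolutionOfSingularities.Theorems.SwitchingDichotomy.FarCleaningDepth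

open IsLocalRing
open Literature.AlgebraicGeometry.CossartPiltant200819.OrderAtClosedPoint
  (derivation_apply_mem_pow derivation_apply_pow_char)

universe u v w

/-! ### Restricting a derivation along an injective algebra map with bounded denominators -/

section Restrict

variable {D : Type u} {F : Type v} [CommRing D] [CommRing F] [Algebra D F]

/-- **Restriction.** If `ι : D → F` is an injective algebra map, `δ` a derivation of `F` and `c ∈ D` is a
common denominator (`ι c · δ(ι d) ∈ ι(D)` for all `d ∈ D`), then `c · δ` restricts to a derivation `∂` of
`D`: `ι (∂ d) = ι c · δ (ι d)`. [folklore] -/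
theorem exists_restrict (δ : Derivation ℤ F F) (hinj : Function.Injective (algebraMap D F)) (c : D)
    (hc : ∀ d : D, algebraMap D F c * δ (algebraMap D F d) ∈ (algebraMap D F).range) :
    ∃ θ : Derivation ℤ D D, ∀ d : D,
      algebraMap D F (θ d) = algebraMap D F c * δ (algebraMap D F d) := by
  classical
  choose φ hφ using fun d => RingHom.mem_range.mp (hc d)
  have hadd : ∀ a b : D, φ (a + b) = φ a + φ b := fun a b =>
    hinj (by rw [map_add, hφ, hφ, hφ, map_add, map_add, mul_add])
  refine ⟨Derivation.mk' (AddMonoidHom.mk' φ hadd).toIntLinearMap ?_, fun d => ?_⟩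
  · intro a b
    apply hinj
    change algebraMap D F (φ (a * b)) = algebraMap D F (a • φ b + b • φ a)
    rw [smul_eq_mul, smul_eq_mul, map_add, map_mul, map_mul, hφ, hφ, hφ, map_mul, Derivation.leibniz,
      smul_eq_mul, smul_eq_mul]
    ring
  · rw [Derivation.coe_mk']
    exact hφ d

end Restrict

/-! ### Common denominators for a derivation of the fraction field of an algebra essentially of finite
type over a perfect field -/

section Denominator

variable (k : Type w) {D : Type u} {F : Type v} [Field k] [CommRing D] [IsDomain D] [Algebra k D]
  [Field F] [Algebra D F] [IsFractionRing D F]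

/-- **Denominators.** For `D` essentially of finite type over a PERFECT field `k` of characteristic `p`
and `δ` any (`ℤ`-)derivation of `F = Frac D`, there is `c ∈ D`, `c ≠ 0`, with `c · δ(D) ⊆ D`: `D` is a
localisation at units of `k[x₁, …, xₙ] ⊆ D`; take `c` = the product of denominators of the `δ xᵢ`
(`δ` kills `k = k^p`, Leibniz handles sums and products, and a unit denominator `t` of `d = a / t` is
removed by `t⁻¹ ∈ D`). [folklore] -/
theorem exists_denominator [PerfectField k] [Algebra.EssFiniteType k D] (p : ℕ) [Fact p.Prime] [CharP k p]
    [CharP F p] (δ : Derivation ℤ F F) :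
    ∃ c : D, c ≠ 0 ∧ ∀ d : D, algebraMap D F c * δ (algebraMap D F d) ∈ (algebraMap D F).range := by
  classical
  obtain ⟨σ, hσ⟩ := (Algebra.essFiniteType_iff k D).mp inferInstance
  -- denominators in `F = Frac D`
  have hden : ∀ z : F, ∃ m : D, m ≠ 0 ∧ z * algebraMap D F m ∈ (algebraMap D F).range := fun z => by
    obtain ⟨⟨a, m⟩, h⟩ := IsLocalization.surj (nonZeroDivisors D) z
    exact ⟨m, nonZeroDivisors.ne_zero m.2, RingHom.mem_range.mpr ⟨a, h.symm⟩⟩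
  choose den hden0 hdenr using hden
  set c : D := ∏ x ∈ σ, den (δ (algebraMap D F x)) with hc
  have hc0 : c ≠ 0 := Finset.prod_ne_zero_iff.mpr fun x _ => hden0 _
  refine ⟨c, hc0, ?_⟩
  -- `c · δ` is integral on the finitely generated subalgebra `k[σ]`
  have hgood : ∀ d ∈ Algebra.adjoin k (σ : Set D),
      algebraMap D F c * δ (algebraMap D F d) ∈ (algebraMap D F).range := by
    intro d hd
    induction hd using Algebra.adjoin_induction with
    | mem x hx =>
      have key := mul_mem (RingHom.mem_range_self (algebraMap D F)
        (∏ y ∈ σ.erase x, den (δ (algebraMap D F y)))) (hdenr (δ (algebraMap D F x)))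
      convert key using 1
      rw [hc, ← Finset.mul_prod_erase σ _ (Finset.mem_coe.mp hx), map_mul]
      ring
    | algebraMap r =>
      haveI : PerfectRing k p := PerfectField.toPerfectRing p
      have hr : algebraMap k D r = (algebraMap k D ((frobeniusEquiv k p).symm r)) ^ p := by
        rw [← map_pow, frobeniusEquiv_symm_pow_p]
      rw [hr, map_pow, derivation_apply_pow_char, mul_zero]
      exact zero_mem _
    | add x y _ _ hx hy =>
      rw [map_add, map_add, mul_add]
      exact add_mem hx hy
    | mul x y _ _ hx hy =>
      have key := add_mem (mul_mem (RingHom.mem_range_self (algebraMap D F) x) hy)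
        (mul_mem (RingHom.mem_range_self (algebraMap D F) y) hx)
      convert key using 1
      rw [map_mul, Derivation.leibniz, smul_eq_mul, smul_eq_mul]
      ring
  -- every `d ∈ D` is `a / t` with `a, t ∈ k[σ]`, `t` a unit of `D`
  intro d
  obtain ⟨t, ht, htu, hdt⟩ := hσ d
  obtain ⟨u, rfl⟩ := htu
  have h1 := hgood _ hdt
  have h2 := hgood _ ht
  have h3 : algebraMap D F ↑u * (algebraMap D F c * δ (algebraMap D F d)) ∈ (algebraMap D F).range := by
    have h := sub_mem h1 (mul_mem (RingHom.mem_range_self (algebraMap D F) d) h2)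
    convert h using 1
    rw [map_mul, Derivation.leibniz, smul_eq_mul, smul_eq_mul]
    ring
  have h4 := mul_mem (RingHom.mem_range_self (algebraMap D F) (↑u⁻¹ : D)) h3
  rwa [← mul_assoc, ← map_mul, Units.inv_mul, map_one, one_mul] at h4

end Denominator

/-! ### Krull: a nonzero element of a Noetherian local ring escapes some power of the maximal ideal -/

section Krull

variable {D : Type u} [CommRing D] [IsNoetherianRing D] [IsLocalRing D]

/-- Krull's intersection theorem, pointwise: `x ≠ 0 ⇒ ∃ n, x ∉ 𝔪 ^ n`. [folklore] -/
theorem exists_notMem_pow_of_ne_zero {x : D} (hx : x ≠ 0) : ∃ n : ℕ, x ∉ maximalIdeal D ^ n := by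
  by_contra h
  push Not at h
  have hmem : x ∈ ⨅ n : ℕ, maximalIdeal D ^ n := Ideal.mem_iInf.mpr h
  rw [(maximalIdeal D).iInf_pow_eq_bot_of_isLocalRing (maximalIdeal.isMaximal D).ne_top] at hmem
  exact hx (Ideal.mem_bot.mp hmem)

end Krull

/-! ### The budget -/

section Budget

variable (k : Type w) {D : Type u} [Field k] [CommRing D] [IsDomain D] [IsDiscreteValuationRing D]
  [Algebra k D] (p : ℕ) [Fact p.Prime] [CharP k p]

omit [Fact p.Prime] in
/-- **Finite cleaning depth, derivation form.** A derivation `∂` of a Noetherian local ring `D` of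
characteristic `p` with `∂ f ≠ 0` bounds the cleaning depth of `f`: `∂` kills `p`-th powers and lowers
`𝔪`-adic orders by at most one, so `f − g^p ∈ 𝔪^{M+1} ⇒ ∂ f ∈ 𝔪^M`, and `∂ f ∉ 𝔪^M` for some `M`
(Krull). [folklore] -/
theorem exists_depth_of_derivation {D : Type u} [CommRing D] [IsNoetherianRing D] [IsLocalRing D]
    [CharP D p] (θ : Derivation ℤ D D) {f : D} (hf : θ f ≠ 0) :
    ∃ N : ℕ, ∀ g : D, f - g ^ p ∉ maximalIdeal D ^ N := by
  obtain ⟨M, hM⟩ := exists_notMem_pow_of_ne_zero hf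
  refine ⟨M + 1, fun g hg => hM ?_⟩
  have h := derivation_apply_mem_pow θ (maximalIdeal D) M hg
  rwa [map_sub, derivation_apply_pow_char, sub_zero] at h

/-- **`FarCleaningDepthFinite p` at a prime `p`, any fraction field `F` of `D`.** [cite: Matsumura1987,
§26 Thm. 26.5] [folklore] -/
theorem exists_depth [PerfectField k] [Algebra.EssFiniteType k D] {F : Type v} [Field F] [Algebra D F]
    [IsFractionRing D F] [Algebra k F] [IsScalarTower k D F] [Algebra.EssFiniteType k F] (f : D)
    (hf : ∀ g : F, algebraMap D F f ≠ g ^ p) :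
    ∃ N : ℕ, ∀ g : D, f - g ^ p ∉ maximalIdeal D ^ N := by
  haveI : CharP F p := charP_of_injective_algebraMap (algebraMap k F).injective p
  haveI : CharP D p := charP_of_injective_algebraMap (algebraMap k D).injective p
  -- detection: a derivation of `F` with `δ f ≠ 0`
  obtain ⟨e, Δ, hΔ⟩ := PBasisDual.exists_derivation_commonKernel k p (F := F)
  have hl : ∃ l, Δ l (algebraMap D F f) ≠ 0 := by
    by_contra h
    push Not at h
    obtain ⟨y, hy⟩ := (hΔ (algebraMap D F f)).mp h
    exact hf y hy.symm
  obtain ⟨l, hl⟩ := hl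
  -- denominators and restriction
  obtain ⟨c, hc0, hc⟩ := exists_denominator k (D := D) p (Δ l)
  obtain ⟨θ, hθ⟩ := exists_restrict (Δ l) (IsFractionRing.injective D F) c hc
  have hθf : θ f ≠ 0 := by
    intro h0
    have h1 := hθ f
    rw [h0, map_zero] at h1
    exact mul_ne_zero ((map_ne_zero_iff _ (IsFractionRing.injective D F)).mpr hc0) hl h1.symm
  exact exists_depth_of_derivation p θ hθf

omit [Fact p.Prime] in
-- `IsDiscreteValuationRing D` takes `[IsDomain D]` as a parameter, so both binders are needed (literal signature).
set_option linter.overlappingInstances false in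
/-- **BUDGET · `FarCleaningDepthFinite`, LITERAL** (body of res-L0-w41-idea-2's
`Idea2g4.FarCleaningDepthFinite p`, `Sketch-idea-2e.lean` §G5b l.779, verbatim, for every `p`): in a
discrete valuation ring `D` essentially of finite type over a perfect field of characteristic `p`, an
element `f` that is not a `p`-th power in `Frac D` has finite cleaning depth —
`∃ N, ∀ g ∈ D, f − g ^ p ∉ 𝔪_D ^ N`.  (`p` is `0` or a prime by `CharP k p`; at `p = 0` the hypothesis reads
`f ≠ 1` and Krull's theorem alone concludes.)  Closes the sketch's def by `exact farCleaningDepthFinite p`.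
[cite: Matsumura1987, §26 Thm. 26.5] [cite: HeinzerEtAl2015, Thm. 4.1 (2)] [folklore] -/
theorem farCleaningDepthFinite (p : ℕ) :
    ∀ (k D : Type) [Field k] [CharP k p] [PerfectField k] [CommRing D] [IsDomain D]
      [IsDiscreteValuationRing D] [Algebra k D] [Algebra.EssFiniteType k D] (f : D),
      (∀ g : FractionRing D, algebraMap D (FractionRing D) f ≠ g ^ p) →
      ∃ N : ℕ, ∀ g : D, f - g ^ p ∉ IsLocalRing.maximalIdeal D ^ N := by
  intro k D _ _ _ _ _ _ _ _ f hf
  rcases CharP.char_is_prime_or_zero k p with hp | rfl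
  · haveI : Fact p.Prime := ⟨hp⟩
    exact exists_depth k p (F := FractionRing D) f hf
  · -- characteristic `0`: `g ^ 0 = 1`, so the hypothesis is `f ≠ 1`
    have h1 : f - 1 ≠ 0 := by
      intro h
      apply hf 0
      rw [pow_zero, sub_eq_zero.mp h, map_one]
    obtain ⟨N, hN⟩ := exists_notMem_pow_of_ne_zero h1
    exact ⟨N, fun g => by rwa [pow_zero]⟩

end Budget

end Summit.ResolutionOfSingularities.ResolutionOfSingularities.Theorems.SwitchingDichotomy.FarCleaningDepth
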